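import Literature.NumberTheory.LFunctions.WeilGroundState
import Literature.NumberTheory.LFunctions.WeilGroundEnergyProofs
import HarnessLib

/-!
# Crux `GroundBarta.PolarPerronFrobenius` (stmt-RiemannHypothesis-18390), line `Sketch`
# (cone–compactness): stub S3 `stub_coneMinimizingSeq` (RH-free)

If at a genuine window `a > 0` the CONE tests (smooth, supported in `[-a, a]`, pointwise real and
`≥ 0`, `L²`-normalised) come within every `δ > 0` of the energy of every normalised window test, then
there is an `L²`-normalised MINIMISING SEQUENCE of cone tests, `Re Q(gₙ) → ε(a) = weilGroundEnergy a`: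
pick a normalised test `hₙ` with `Re Q(hₙ) < ε(a) + 1/(2(n+1))` (`ε(a)` is the infimum of the bounded
below, nonempty sphere: `bddBelow_weilQuadratic_sphere_holds`, `exists_isWeilTest_sphere`), match it by
a cone test `gₙ` up to `1/(2(n+1))`, and squeeze between `ε(a)` and `ε(a) + 1/(n+1)`.
Mathlib + proved tree files only; no named fact.
-/

set_option linter.dupNamespace false

noncomputable section

open Set MeasureTheory Filter Complex
open scoped Topology

namespace Summit.RiemannHypothesis.RiemannHypothesis.Theorems.PolarPerronFrobenius

open Literature.NumberTheory.LFunctions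

/-- **Stub S3 of line `Sketch` (cone–compactness) — a minimising sequence of cone tests.**
Cone density at a window `a > 0` yields normalised cone tests `gₙ` with `Re Q(gₙ) → ε(a)`. -/
theorem stub_coneMinimizingSeq :
    ∀ a : ℝ, 0 < a →
      (∀ h : ℝ → ℂ, Literature.NumberTheory.LFunctions.IsWeilTest h → tsupport h ⊆ Set.Icc (-a) a →
          ∫ t, ‖h t‖ ^ 2 = (1 : ℝ) → ∀ δ : ℝ, 0 < δ →
            ∃ w : ℝ → ℂ, Literature.NumberTheory.LFunctions.IsWeilTest w ∧
              tsupport w ⊆ Set.Icc (-a) a ∧ (∀ t, (w t).im = 0 ∧ 0 ≤ (w t).re) ∧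
              ∫ t, ‖w t‖ ^ 2 = (1 : ℝ) ∧
              (Literature.NumberTheory.LFunctions.weilQuadratic w).re ≤
                (Literature.NumberTheory.LFunctions.weilQuadratic h).re + δ) →
      ∃ g : ℕ → ℝ → ℂ,
        (∀ n, Literature.NumberTheory.LFunctions.IsWeilTest (g n) ∧ tsupport (g n) ⊆ Set.Icc (-a) a ∧
          (∀ t, (g n t).im = 0 ∧ 0 ≤ (g n t).re) ∧ ∫ t, ‖g n t‖ ^ 2 = (1 : ℝ)) ∧
        Filter.Tendsto (fun n => (Literature.NumberTheory.LFunctions.weilQuadratic (g n)).re)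
          Filter.atTop (nhds (Literature.NumberTheory.LFunctions.weilGroundEnergy a)) := by
  intro a ha hcone
  set S : Set ℝ := {x : ℝ | ∃ g : ℝ → ℂ, IsWeilTest g ∧ tsupport g ⊆ Icc (-a) a ∧
    ∫ t : ℝ, ‖g t‖ ^ 2 = 1 ∧ x = (weilQuadratic g).re} with hSdef
  have hS : BddBelow S := bddBelow_weilQuadratic_sphere_holds a
  have hε : weilGroundEnergy a = sInf S := rfl
  have hne : S.Nonempty := by
    obtain ⟨g, hg, hs, hn⟩ := exists_isWeilTest_sphere ha
    exact ⟨_, g, hg, hs, hn, rfl⟩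
  have hlow : ∀ {w : ℝ → ℂ}, IsWeilTest w → tsupport w ⊆ Icc (-a) a → ∫ t, ‖w t‖ ^ 2 = (1 : ℝ) →
      weilGroundEnergy a ≤ (weilQuadratic w).re := fun hw hws hwn =>
    csInf_le hS ⟨_, hw, hws, hwn, rfl⟩
  -- one cone test per `n`, `1/(n+1)`-close to the bottom
  have step : ∀ n : ℕ, ∃ w : ℝ → ℂ, IsWeilTest w ∧ tsupport w ⊆ Icc (-a) a ∧
      (∀ t, (w t).im = 0 ∧ 0 ≤ (w t).re) ∧ ∫ t, ‖w t‖ ^ 2 = (1 : ℝ) ∧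
      (weilQuadratic w).re ≤ weilGroundEnergy a + 1 / ((n : ℝ) + 1) := by
    intro n
    have hδ : (0 : ℝ) < 1 / (2 * ((n : ℝ) + 1)) := by positivity
    have hlt : sInf S < weilGroundEnergy a + 1 / (2 * ((n : ℝ) + 1)) := by rw [← hε]; linarith
    obtain ⟨y, ⟨h, hh, hsupp, hnorm, rfl⟩, hy⟩ := exists_lt_of_csInf_lt hne hlt
    obtain ⟨w, hw, hws, hwsign, hwn, hwle⟩ := hcone h hh hsupp hnorm _ hδ
    refine ⟨w, hw, hws, hwsign, hwn, ?_⟩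
    have e : 1 / (2 * ((n : ℝ) + 1)) + 1 / (2 * ((n : ℝ) + 1)) = 1 / ((n : ℝ) + 1) := by
      field_simp; ring
    linarith
  choose g hg hgs hgsign hgn hgle using step
  refine ⟨g, fun n => ⟨hg n, hgs n, hgsign n, hgn n⟩, ?_⟩
  -- squeeze
  have hup : Tendsto (fun n : ℕ => weilGroundEnergy a + 1 / ((n : ℝ) + 1)) atTop
      (𝓝 (weilGroundEnergy a)) := by
    have h := (tendsto_const_nhds (x := weilGroundEnergy a) (f := (atTop : Filter ℕ))).add
      tendsto_one_div_add_atTop_nhds_zero_nat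
    rw [add_zero] at h
    exact h
  exact tendsto_of_tendsto_of_tendsto_of_le_of_le tendsto_const_nhds hup
    (fun n => hlow (hg n) (hgs n) (hgn n)) (fun n => hgle n)

end Summit.RiemannHypothesis.RiemannHypothesis.Theorems.PolarPerronFrobenius

end
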